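import Summits.Ventures.QEC.Census.RankCert
import HarnessLib

/-!
# CSS census rows in the kernel (CalibCSSN01to04): exact `[[n, k, d]]`, `d^X`, `d^Z` for the calibCSS cells n ≤ 4

LADDER-QEC (venture cell `qec`), CENSUS-PREREG C.2 («all CSS codes from classical pairs `C₂^⊥ ⊆ C₁` … compared cell by
cell»; companion table census/search-5/css-n12/CSS-CALIB.tsv, qec-search-5: best CSS distance per cell `(n, k)`,
`n ≤ 12`, every instance certA ∧ certB ∧ ref-1 = tier COMPUTED in census/TABLE.tsv, family `calibCSS`, ids
`css_n<N>_k<K>`). This file is the KERNEL column of the LOWER half of those cells (existence with the exact parameters):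
for each row the CSS code (type-02 `CSSCode.ofMatrices`, Literature/…/CSS.lean) whose check matrices are the LITERAL gens
rows (`rowMatrix n <bitmasks>`, bit `j` = qubit `j` = character `j` of the gens string «leftmost = qubit 0») is proved
to be EXACTLY `[[n, k, d]]` (`CSSCode.IsCode`: `|Q| = n`, `k = n − rk H^X − rk H^Z`, `cssMinDist = d`) with its two
sector distances `d^X`, `d^Z`, by qec-type-10's distance-certificate checker `DistCert.checkDistCert`
(Census/CertCheck.lean: commutation, weight-`d` logical + non-membership witness, bruteforce replay of every word of
weight `< d` against the allow-list of low-weight stabilizers) and qec-type-02's rank certificates `RankCert.check`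
(Census/RankCert.lean), assembled by `DistCert.isCode_code`; every check is ONE `decide` (≤ 300-word replays) —
tier KERNEL-std, axioms ⊆ {propext, Classical.choice, Quot.sound}, no `native_decide`. The `k = 0` cells (CRSS
convention) and the UPPER half (no CSS `[[n, k, d+1]]`) are separate files. Certificates found and checked in-seat by
qec-type-02's `emit_css_calib.py` from the gens files alone (nothing from the producer is trusted: the kernel
recomputes every syndrome, weight, XOR and parity). HONEST FRAMING: these are statements about the 78 + 12 explicit
instances of the table, not about optimality; coverage of the cell grid is search-5's sentence (CSS-LP upper bounds,
COMPUTED), not claimed here. [folklore] throughout (elementary linear algebra over `𝔽₂`).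
-/

namespace Summit.Ventures.QEC.Census.CSS

open Summit.Ventures.QEC.Census Literature.InformationTheory.QuantumCodes

/-- Census row `css_n1_k1` (family `calibCSS`, CENSUS-PREREG C.2; gens census/search-5/css-n12/css_gens/css_n1_k1.txt, GENS-SHA matrix_sha256 `06867f512e925235…`, file_sha16 `a316774b8a5983da`; certA `5f3ab16149e4be05` ∧ certB `8bd4d0a1959fa485`, ref-1 signed; search-5 provenance: trivial CSS [[1,1,1]]). The CSS code with the LITERAL check rows `H^X = []`, `H^Z = []` (bitmasks, bit `j` = qubit `j` = character `j` of the gens string) is EXACTLY a `[[1, 1, 1]]` code (`d^X = 1`, `d^Z = 1`): distance certificate (type-10 `DistCert`, bruteforce replay of 0 words) + two rank certificates (type-02 `RankCert`, `r_X = 0`, `r_Z = 0`), all by `decide` — tier KERNEL-std. [folklore] -/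
theorem check_css_n1_k1 :
    ({ n := 1, HX := [], HZ := [],
        sideZ := { d := 1, witness := 1, nonmember := 1, found := [] },
        sideX := { d := 1, witness := 1, nonmember := 1, found := [] } } : DistCert).checkDistCert = true := by
  decide

/-- Rank certificate of `H^X` of `css_n1_k1` accepted (`rank = 0`, `decide`). [folklore] -/
theorem rankX_css_n1_k1 : ({ r := 0, pivots := [], rinv := [], dependent := [] } : RankCert).check 1 [] = true := by
  decide

/-- Rank certificate of `H^Z` of `css_n1_k1` accepted (`rank = 0`, `decide`). [folklore] -/
theorem rankZ_css_n1_k1 : ({ r := 0, pivots := [], rinv := [], dependent := [] } : RankCert).check 1 [] = true := by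
  decide

/-- **`css_n1_k1` is a `[[1, 1, 1]]` CSS code** (exact parameters, `CSSCode.IsCode`; KERNEL-std). [folklore] -/
theorem isCode_css_n1_k1 :
    (CSSCode.ofMatrices (rowMatrix 1 []) (rowMatrix 1 [])
      (comm_of_commOK (DistCert.commOK_of_check _ check_css_n1_k1))).IsCode 1 1 1 :=
  DistCert.isCode_code _ check_css_n1_k1 rankX_css_n1_k1 rankZ_css_n1_k1 (by decide)

/-- `d^X = 1` for `css_n1_k1` (KERNEL-std). [folklore] -/
theorem dX_css_n1_k1 :
    (CSSCode.ofMatrices (rowMatrix 1 []) (rowMatrix 1 [])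
      (comm_of_commOK (DistCert.commOK_of_check _ check_css_n1_k1))).dX = 1 :=
  DistCert.dX_code _ check_css_n1_k1

/-- `d^Z = 1` for `css_n1_k1` (KERNEL-std). [folklore] -/
theorem dZ_css_n1_k1 :
    (CSSCode.ofMatrices (rowMatrix 1 []) (rowMatrix 1 [])
      (comm_of_commOK (DistCert.commOK_of_check _ check_css_n1_k1))).dZ = 1 :=
  DistCert.dZ_code _ check_css_n1_k1

/-- Census row `css_n2_k1` (family `calibCSS`, CENSUS-PREREG C.2; gens census/search-5/css-n12/css_gens/css_n2_k1.txt, GENS-SHA matrix_sha256 `af078e4c8cf52a9f…`, file_sha16 `3e5ab82dab3b88ad`; certA `9e038d2bc1fdb924` ∧ certB `6efe3ea5124872b0`, ref-1 signed; search-5 provenance: trivial CSS [[2,1,1]]). The CSS code with the LITERAL check rows `H^X = []`, `H^Z = [1]` (bitmasks, bit `j` = qubit `j` = character `j` of the gens string) is EXACTLY a `[[2, 1, 1]]` code (`d^X = 1`, `d^Z = 1`): distance certificate (type-10 `DistCert`, bruteforce replay of 0 words) + two rank certificates (type-02 `RankCert`, `r_X = 0`, `r_Z = 1`), all by `decide`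 — tier KERNEL-std. [folklore] -/
theorem check_css_n2_k1 :
    ({ n := 2, HX := [], HZ := [1],
        sideZ := { d := 1, witness := 2, nonmember := 2, found := [] },
        sideX := { d := 1, witness := 2, nonmember := 2, found := [] } } : DistCert).checkDistCert = true := by
  decide

/-- Rank certificate of `H^X` of `css_n2_k1` accepted (`rank = 0`, `decide`). [folklore] -/
theorem rankX_css_n2_k1 : ({ r := 0, pivots := [], rinv := [], dependent := [] } : RankCert).check 2 [] = true := by
  decide

/-- Rank certificate of `H^Z` of `css_n2_k1` accepted (`rank = 1`, `decide`). [folklore] -/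
theorem rankZ_css_n2_k1 : ({ r := 1, pivots := [0], rinv := [1], dependent := [] } : RankCert).check 2 [1] = true := by
  decide

/-- **`css_n2_k1` is a `[[2, 1, 1]]` CSS code** (exact parameters, `CSSCode.IsCode`; KERNEL-std). [folklore] -/
theorem isCode_css_n2_k1 :
    (CSSCode.ofMatrices (rowMatrix 2 []) (rowMatrix 2 [1])
      (comm_of_commOK (DistCert.commOK_of_check _ check_css_n2_k1))).IsCode 2 1 1 :=
  DistCert.isCode_code _ check_css_n2_k1 rankX_css_n2_k1 rankZ_css_n2_k1 (by decide)

/-- `d^X = 1` for `css_n2_k1` (KERNEL-std). [folklore] -/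
theorem dX_css_n2_k1 :
    (CSSCode.ofMatrices (rowMatrix 2 []) (rowMatrix 2 [1])
      (comm_of_commOK (DistCert.commOK_of_check _ check_css_n2_k1))).dX = 1 :=
  DistCert.dX_code _ check_css_n2_k1

/-- `d^Z = 1` for `css_n2_k1` (KERNEL-std). [folklore] -/
theorem dZ_css_n2_k1 :
    (CSSCode.ofMatrices (rowMatrix 2 []) (rowMatrix 2 [1])
      (comm_of_commOK (DistCert.commOK_of_check _ check_css_n2_k1))).dZ = 1 :=
  DistCert.dZ_code _ check_css_n2_k1

/-- Census row `css_n2_k2` (family `calibCSS`, CENSUS-PREREG C.2; gens census/search-5/css-n12/css_gens/css_n2_k2.txt, GENS-SHA matrix_sha256 `77d718603f5bfdff…`, file_sha16 `0f34a7cee456f26b`; certA `beb97e61ce6e1f8c` ∧ certB `1cbef2616ef536c7`, ref-1 signed; search-5 provenance: trivial CSS [[2,2,1]]). The CSS code with the LITERAL check rows `H^X = []`, `H^Z = []` (bitmasks, bit `j` = qubit `j` = character `j` of the gens string) is EXACTLY a `[[2, 2, 1]]` code (`d^X = 1`, `d^Z = 1`): distance certificate (type-10 `DistCert`, bruteforce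 replay of 0 words) + two rank certificates (type-02 `RankCert`, `r_X = 0`, `r_Z = 0`), all by `decide` — tier KERNEL-std. [folklore] -/
theorem check_css_n2_k2 :
    ({ n := 2, HX := [], HZ := [],
        sideZ := { d := 1, witness := 1, nonmember := 1, found := [] },
        sideX := { d := 1, witness := 1, nonmember := 1, found := [] } } : DistCert).checkDistCert = true := by
  decide

/-- Rank certificate of `H^X` of `css_n2_k2` accepted (`rank = 0`, `decide`). [folklore] -/
theorem rankX_css_n2_k2 : ({ r := 0, pivots := [], rinv := [], dependent := [] } : RankCert).check 2 [] = true := by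
  decide

/-- Rank certificate of `H^Z` of `css_n2_k2` accepted (`rank = 0`, `decide`). [folklore] -/
theorem rankZ_css_n2_k2 : ({ r := 0, pivots := [], rinv := [], dependent := [] } : RankCert).check 2 [] = true := by
  decide

/-- **`css_n2_k2` is a `[[2, 2, 1]]` CSS code** (exact parameters, `CSSCode.IsCode`; KERNEL-std). [folklore] -/
theorem isCode_css_n2_k2 :
    (CSSCode.ofMatrices (rowMatrix 2 []) (rowMatrix 2 [])
      (comm_of_commOK (DistCert.commOK_of_check _ check_css_n2_k2))).IsCode 2 2 1 :=
  DistCert.isCode_code _ check_css_n2_k2 rankX_css_n2_k2 rankZ_css_n2_k2 (by decide)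

/-- `d^X = 1` for `css_n2_k2` (KERNEL-std). [folklore] -/
theorem dX_css_n2_k2 :
    (CSSCode.ofMatrices (rowMatrix 2 []) (rowMatrix 2 [])
      (comm_of_commOK (DistCert.commOK_of_check _ check_css_n2_k2))).dX = 1 :=
  DistCert.dX_code _ check_css_n2_k2

/-- `d^Z = 1` for `css_n2_k2` (KERNEL-std). [folklore] -/
theorem dZ_css_n2_k2 :
    (CSSCode.ofMatrices (rowMatrix 2 []) (rowMatrix 2 [])
      (comm_of_commOK (DistCert.commOK_of_check _ check_css_n2_k2))).dZ = 1 :=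
  DistCert.dZ_code _ check_css_n2_k2

/-- Census row `css_n3_k1` (family `calibCSS`, CENSUS-PREREG C.2; gens census/search-5/css-n12/css_gens/css_n3_k1.txt, GENS-SHA matrix_sha256 `9d361bbeb3b87e1d…`, file_sha16 `a4cdeb76ecd2ffba`; certA `60466ed5fb336094` ∧ certB `124b4bf045b42e45`, ref-1 signed; search-5 provenance: trivial CSS [[3,1,1]]). The CSS code with the LITERAL check rows `H^X = []`, `H^Z = [2, 1]` (bitmasks, bit `j` = qubit `j` = character `j` of the gens string) is EXACTLY a `[[3, 1, 1]]` code (`d^X = 1`, `d^Z = 1`): distance certificate (type-10 `DistCert`, bruteforce replay of 0 words) + two rank certificates (type-02 `RankCert`, `r_X = 0`, `r_Z = 2`), all by `decide` — tier KERNEL-std. [folklore] -/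
theorem check_css_n3_k1 :
    ({ n := 3, HX := [], HZ := [2, 1],
        sideZ := { d := 1, witness := 4, nonmember := 4, found := [] },
        sideX := { d := 1, witness := 4, nonmember := 4, found := [] } } : DistCert).checkDistCert = true := by
  decide

/-- Rank certificate of `H^X` of `css_n3_k1` accepted (`rank = 0`, `decide`). [folklore] -/
theorem rankX_css_n3_k1 : ({ r := 0, pivots := [], rinv := [], dependent := [] } : RankCert).check 3 [] = true := by
  decide

/-- Rank certificate of `H^Z` of `css_n3_k1` accepted (`rank = 2`, `decide`). [folklore] -/
theorem rankZ_css_n3_k1 : ({ r := 2, pivots := [0, 1], rinv := [2, 1], dependent := [] } : RankCert).check 3 [2, 1] = true := by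
  decide

/-- **`css_n3_k1` is a `[[3, 1, 1]]` CSS code** (exact parameters, `CSSCode.IsCode`; KERNEL-std). [folklore] -/
theorem isCode_css_n3_k1 :
    (CSSCode.ofMatrices (rowMatrix 3 []) (rowMatrix 3 [2, 1])
      (comm_of_commOK (DistCert.commOK_of_check _ check_css_n3_k1))).IsCode 3 1 1 :=
  DistCert.isCode_code _ check_css_n3_k1 rankX_css_n3_k1 rankZ_css_n3_k1 (by decide)

/-- `d^X = 1` for `css_n3_k1` (KERNEL-std). [folklore] -/
theorem dX_css_n3_k1 :
    (CSSCode.ofMatrices (rowMatrix 3 []) (rowMatrix 3 [2, 1])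
      (comm_of_commOK (DistCert.commOK_of_check _ check_css_n3_k1))).dX = 1 :=
  DistCert.dX_code _ check_css_n3_k1

/-- `d^Z = 1` for `css_n3_k1` (KERNEL-std). [folklore] -/
theorem dZ_css_n3_k1 :
    (CSSCode.ofMatrices (rowMatrix 3 []) (rowMatrix 3 [2, 1])
      (comm_of_commOK (DistCert.commOK_of_check _ check_css_n3_k1))).dZ = 1 :=
  DistCert.dZ_code _ check_css_n3_k1

/-- Census row `css_n3_k2` (family `calibCSS`, CENSUS-PREREG C.2; gens census/search-5/css-n12/css_gens/css_n3_k2.txt, GENS-SHA matrix_sha256 `7b1d883c7d667e14…`, file_sha16 `550bf8ede361b78f`; certA `dd76cf1b76860616` ∧ certB `679311b3f9fcdf36`, ref-1 signed; search-5 provenance: trivial CSS [[3,2,1]]). The CSS code with the LITERAL check rows `H^X = []`, `H^Z = [1]` (bitmasks, bit `j` = qubit `j` = character `j` of the gens string) is EXACTLY a `[[3, 2, 1]]` code (`d^X = 1`, `d^Z = 1`): distance certificate (type-10 `DistCert`, bruteforce replay of 0 words) + two rank certificates (type-02 `RankCert`, `r_X = 0`, `r_Z = 1`), all by `decide` — tier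 KERNEL-std. [folklore] -/
theorem check_css_n3_k2 :
    ({ n := 3, HX := [], HZ := [1],
        sideZ := { d := 1, witness := 2, nonmember := 2, found := [] },
        sideX := { d := 1, witness := 2, nonmember := 2, found := [] } } : DistCert).checkDistCert = true := by
  decide

/-- Rank certificate of `H^X` of `css_n3_k2` accepted (`rank = 0`, `decide`). [folklore] -/
theorem rankX_css_n3_k2 : ({ r := 0, pivots := [], rinv := [], dependent := [] } : RankCert).check 3 [] = true := by
  decide

/-- Rank certificate of `H^Z` of `css_n3_k2` accepted (`rank = 1`, `decide`). [folklore] -/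
theorem rankZ_css_n3_k2 : ({ r := 1, pivots := [0], rinv := [1], dependent := [] } : RankCert).check 3 [1] = true := by
  decide

/-- **`css_n3_k2` is a `[[3, 2, 1]]` CSS code** (exact parameters, `CSSCode.IsCode`; KERNEL-std). [folklore] -/
theorem isCode_css_n3_k2 :
    (CSSCode.ofMatrices (rowMatrix 3 []) (rowMatrix 3 [1])
      (comm_of_commOK (DistCert.commOK_of_check _ check_css_n3_k2))).IsCode 3 2 1 :=
  DistCert.isCode_code _ check_css_n3_k2 rankX_css_n3_k2 rankZ_css_n3_k2 (by decide)

/-- `d^X = 1` for `css_n3_k2` (KERNEL-std). [folklore] -/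
theorem dX_css_n3_k2 :
    (CSSCode.ofMatrices (rowMatrix 3 []) (rowMatrix 3 [1])
      (comm_of_commOK (DistCert.commOK_of_check _ check_css_n3_k2))).dX = 1 :=
  DistCert.dX_code _ check_css_n3_k2

/-- `d^Z = 1` for `css_n3_k2` (KERNEL-std). [folklore] -/
theorem dZ_css_n3_k2 :
    (CSSCode.ofMatrices (rowMatrix 3 []) (rowMatrix 3 [1])
      (comm_of_commOK (DistCert.commOK_of_check _ check_css_n3_k2))).dZ = 1 :=
  DistCert.dZ_code _ check_css_n3_k2

/-- Census row `css_n3_k3` (family `calibCSS`, CENSUS-PREREG C.2; gens census/search-5/css-n12/css_gens/css_n3_k3.txt, GENS-SHA matrix_sha256 `26704e3ab714c77f…`, file_sha16 `5318eab07fa85132`; certA `6edf030af95edb9b` ∧ certB `f56989ef2afe1488`, ref-1 signed; search-5 provenance: trivial CSS [[3,3,1]]). The CSS code with the LITERAL check rows `H^X = []`, `H^Z = []` (bitmasks, bit `j` = qubit `j` = character `j` of the gens string) is EXACTLY a `[[3, 3, 1]]` code (`d^X = 1`, `d^Z = 1`): distance certificate (type-10 `DistCert`, bruteforce replay of 0 words)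 + two rank certificates (type-02 `RankCert`, `r_X = 0`, `r_Z = 0`), all by `decide` — tier KERNEL-std. [folklore] -/
theorem check_css_n3_k3 :
    ({ n := 3, HX := [], HZ := [],
        sideZ := { d := 1, witness := 1, nonmember := 1, found := [] },
        sideX := { d := 1, witness := 1, nonmember := 1, found := [] } } : DistCert).checkDistCert = true := by
  decide

/-- Rank certificate of `H^X` of `css_n3_k3` accepted (`rank = 0`, `decide`). [folklore] -/
theorem rankX_css_n3_k3 : ({ r := 0, pivots := [], rinv := [], dependent := [] } : RankCert).check 3 [] = true := by
  decide

/-- Rank certificate of `H^Z` of `css_n3_k3` accepted (`rank = 0`, `decide`). [folklore] -/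
theorem rankZ_css_n3_k3 : ({ r := 0, pivots := [], rinv := [], dependent := [] } : RankCert).check 3 [] = true := by
  decide

/-- **`css_n3_k3` is a `[[3, 3, 1]]` CSS code** (exact parameters, `CSSCode.IsCode`; KERNEL-std). [folklore] -/
theorem isCode_css_n3_k3 :
    (CSSCode.ofMatrices (rowMatrix 3 []) (rowMatrix 3 [])
      (comm_of_commOK (DistCert.commOK_of_check _ check_css_n3_k3))).IsCode 3 3 1 :=
  DistCert.isCode_code _ check_css_n3_k3 rankX_css_n3_k3 rankZ_css_n3_k3 (by decide)

/-- `d^X = 1` for `css_n3_k3` (KERNEL-std). [folklore] -/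
theorem dX_css_n3_k3 :
    (CSSCode.ofMatrices (rowMatrix 3 []) (rowMatrix 3 [])
      (comm_of_commOK (DistCert.commOK_of_check _ check_css_n3_k3))).dX = 1 :=
  DistCert.dX_code _ check_css_n3_k3

/-- `d^Z = 1` for `css_n3_k3` (KERNEL-std). [folklore] -/
theorem dZ_css_n3_k3 :
    (CSSCode.ofMatrices (rowMatrix 3 []) (rowMatrix 3 [])
      (comm_of_commOK (DistCert.commOK_of_check _ check_css_n3_k3))).dZ = 1 :=
  DistCert.dZ_code _ check_css_n3_k3

/-- Census row `css_n4_k1` (family `calibCSS`, CENSUS-PREREG C.2; gens census/search-5/css-n12/css_gens/css_n4_k1.txt, GENS-SHA matrix_sha256 `27690a59142f249f…`, file_sha16 `e1b414149401795f`; certA `47288e07b3aa02f4` ∧ certB `f51f95545759a055`, ref-1 signed; search-5 provenance: sub0([[4,2,2]] A=B=<1^n>)). The CSS code with the LITERAL check rows `H^X = [15]`, `H^Z = [10, 5]` (bitmasks, bit `j` = qubit `j` = character `j` of the gens string) is EXACTLY a `[[4, 1, 2]]` code (`d^X = 2`, `d^Z = 2`): distance certificate (type-10 `DistCert`, bruteforce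 replay of 8 words) + two rank certificates (type-02 `RankCert`, `r_X = 1`, `r_Z = 2`), all by `decide` — tier KERNEL-std. [folklore] -/
theorem check_css_n4_k1 :
    ({ n := 4, HX := [15], HZ := [10, 5],
        sideZ := { d := 2, witness := 3, nonmember := 5, found := [] },
        sideX := { d := 2, witness := 5, nonmember := 3, found := [] } } : DistCert).checkDistCert = true := by
  decide

/-- Rank certificate of `H^X` of `css_n4_k1` accepted (`rank = 1`, `decide`). [folklore] -/
theorem rankX_css_n4_k1 : ({ r := 1, pivots := [0], rinv := [1], dependent := [] } : RankCert).check 4 [15] = true := by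
  decide

/-- Rank certificate of `H^Z` of `css_n4_k1` accepted (`rank = 2`, `decide`). [folklore] -/
theorem rankZ_css_n4_k1 : ({ r := 2, pivots := [0, 1], rinv := [2, 1], dependent := [] } : RankCert).check 4 [10, 5] = true := by
  decide

/-- **`css_n4_k1` is a `[[4, 1, 2]]` CSS code** (exact parameters, `CSSCode.IsCode`; KERNEL-std). [folklore] -/
theorem isCode_css_n4_k1 :
    (CSSCode.ofMatrices (rowMatrix 4 [15]) (rowMatrix 4 [10, 5])
      (comm_of_commOK (DistCert.commOK_of_check _ check_css_n4_k1))).IsCode 4 1 2 :=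
  DistCert.isCode_code _ check_css_n4_k1 rankX_css_n4_k1 rankZ_css_n4_k1 (by decide)

/-- `d^X = 2` for `css_n4_k1` (KERNEL-std). [folklore] -/
theorem dX_css_n4_k1 :
    (CSSCode.ofMatrices (rowMatrix 4 [15]) (rowMatrix 4 [10, 5])
      (comm_of_commOK (DistCert.commOK_of_check _ check_css_n4_k1))).dX = 2 :=
  DistCert.dX_code _ check_css_n4_k1

/-- `d^Z = 2` for `css_n4_k1` (KERNEL-std). [folklore] -/
theorem dZ_css_n4_k1 :
    (CSSCode.ofMatrices (rowMatrix 4 [15]) (rowMatrix 4 [10, 5])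
      (comm_of_commOK (DistCert.commOK_of_check _ check_css_n4_k1))).dZ = 2 :=
  DistCert.dZ_code _ check_css_n4_k1

/-- Census row `css_n4_k2` (family `calibCSS`, CENSUS-PREREG C.2; gens census/search-5/css-n12/css_gens/css_n4_k2.txt, GENS-SHA matrix_sha256 `2fd1124b690d9b09…`, file_sha16 `a3dca6ead4ec4606`; certA `c559d2c23cc70dc1` ∧ certB `20275890472a2b51`, ref-1 signed; search-5 provenance: [[4,2,2]] A=B=<1^n>). The CSS code with the LITERAL check rows `H^X = [15]`, `H^Z = [15]` (bitmasks, bit `j` = qubit `j` = character `j` of the gens string) is EXACTLY a `[[4, 2, 2]]` code (`d^X = 2`, `d^Z = 2`): distance certificate (type-10 `DistCert`, bruteforce replay of 8 words) + two rank certificates (type-02 `RankCert`, `r_X = 1`, `r_Z = 1`), all by `decide` — tier KERNEL-std. [folklore] -/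
theorem check_css_n4_k2 :
    ({ n := 4, HX := [15], HZ := [15],
        sideZ := { d := 2, witness := 3, nonmember := 5, found := [] },
        sideX := { d := 2, witness := 3, nonmember := 5, found := [] } } : DistCert).checkDistCert = true := by
  decide

/-- Rank certificate of `H^X` of `css_n4_k2` accepted (`rank = 1`, `decide`). [folklore] -/
theorem rankX_css_n4_k2 : ({ r := 1, pivots := [0], rinv := [1], dependent := [] } : RankCert).check 4 [15] = true := by
  decide

/-- Rank certificate of `H^Z` of `css_n4_k2` accepted (`rank = 1`, `decide`). [folklore] -/
theorem rankZ_css_n4_k2 : ({ r := 1, pivots := [0], rinv := [1], dependent := [] } : RankCert).check 4 [15] = true := by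
  decide

/-- **`css_n4_k2` is a `[[4, 2, 2]]` CSS code** (exact parameters, `CSSCode.IsCode`; KERNEL-std). [folklore] -/
theorem isCode_css_n4_k2 :
    (CSSCode.ofMatrices (rowMatrix 4 [15]) (rowMatrix 4 [15])
      (comm_of_commOK (DistCert.commOK_of_check _ check_css_n4_k2))).IsCode 4 2 2 :=
  DistCert.isCode_code _ check_css_n4_k2 rankX_css_n4_k2 rankZ_css_n4_k2 (by decide)

/-- `d^X = 2` for `css_n4_k2` (KERNEL-std). [folklore] -/
theorem dX_css_n4_k2 :
    (CSSCode.ofMatrices (rowMatrix 4 [15]) (rowMatrix 4 [15])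
      (comm_of_commOK (DistCert.commOK_of_check _ check_css_n4_k2))).dX = 2 :=
  DistCert.dX_code _ check_css_n4_k2

/-- `d^Z = 2` for `css_n4_k2` (KERNEL-std). [folklore] -/
theorem dZ_css_n4_k2 :
    (CSSCode.ofMatrices (rowMatrix 4 [15]) (rowMatrix 4 [15])
      (comm_of_commOK (DistCert.commOK_of_check _ check_css_n4_k2))).dZ = 2 :=
  DistCert.dZ_code _ check_css_n4_k2

/-- Census row `css_n4_k3` (family `calibCSS`, CENSUS-PREREG C.2; gens census/search-5/css-n12/css_gens/css_n4_k3.txt, GENS-SHA matrix_sha256 `557687068d860f02…`, file_sha16 `c8903fbc22fbc6c4`; certA `9c0470058b42201b` ∧ certB `7859a7ba98771d11`, ref-1 signed; search-5 provenance: trivial CSS [[4,3,1]]). The CSS code with the LITERAL check rows `H^X = []`, `H^Z = [1]` (bitmasks, bit `j` = qubit `j` = character `j` of the gens string) is EXACTLY a `[[4, 3, 1]]` code (`d^X = 1`, `d^Z = 1`): distance certificate (type-10 `DistCert`, bruteforce replay of 0 words) + two rank certificates (type-02 `RankCert`, `r_X = 0`, `r_Z = 1`), all by `decide` — tier KERNEL-std.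 [folklore] -/
theorem check_css_n4_k3 :
    ({ n := 4, HX := [], HZ := [1],
        sideZ := { d := 1, witness := 2, nonmember := 2, found := [] },
        sideX := { d := 1, witness := 2, nonmember := 2, found := [] } } : DistCert).checkDistCert = true := by
  decide

/-- Rank certificate of `H^X` of `css_n4_k3` accepted (`rank = 0`, `decide`). [folklore] -/
theorem rankX_css_n4_k3 : ({ r := 0, pivots := [], rinv := [], dependent := [] } : RankCert).check 4 [] = true := by
  decide

/-- Rank certificate of `H^Z` of `css_n4_k3` accepted (`rank = 1`, `decide`). [folklore] -/
theorem rankZ_css_n4_k3 : ({ r := 1, pivots := [0], rinv := [1], dependent := [] } : RankCert).check 4 [1] = true := by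
  decide

/-- **`css_n4_k3` is a `[[4, 3, 1]]` CSS code** (exact parameters, `CSSCode.IsCode`; KERNEL-std). [folklore] -/
theorem isCode_css_n4_k3 :
    (CSSCode.ofMatrices (rowMatrix 4 []) (rowMatrix 4 [1])
      (comm_of_commOK (DistCert.commOK_of_check _ check_css_n4_k3))).IsCode 4 3 1 :=
  DistCert.isCode_code _ check_css_n4_k3 rankX_css_n4_k3 rankZ_css_n4_k3 (by decide)

/-- `d^X = 1` for `css_n4_k3` (KERNEL-std). [folklore] -/
theorem dX_css_n4_k3 :
    (CSSCode.ofMatrices (rowMatrix 4 []) (rowMatrix 4 [1])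
      (comm_of_commOK (DistCert.commOK_of_check _ check_css_n4_k3))).dX = 1 :=
  DistCert.dX_code _ check_css_n4_k3

/-- `d^Z = 1` for `css_n4_k3` (KERNEL-std). [folklore] -/
theorem dZ_css_n4_k3 :
    (CSSCode.ofMatrices (rowMatrix 4 []) (rowMatrix 4 [1])
      (comm_of_commOK (DistCert.commOK_of_check _ check_css_n4_k3))).dZ = 1 :=
  DistCert.dZ_code _ check_css_n4_k3

/-- Census row `css_n4_k4` (family `calibCSS`, CENSUS-PREREG C.2; gens census/search-5/css-n12/css_gens/css_n4_k4.txt, GENS-SHA matrix_sha256 `df1f20f6b36a1b97…`, file_sha16 `a4a6f735ffbca8e9`; certA `301812b371551362` ∧ certB `34713b5e52fdf027`, ref-1 signed; search-5 provenance: trivial CSS [[4,4,1]]). The CSS code with the LITERAL check rows `H^X = []`, `H^Z = []` (bitmasks, bit `j` = qubit `j` = character `j` of the gens string) is EXACTLY a `[[4, 4, 1]]` code (`d^X = 1`, `d^Z = 1`): distance certificate (type-10 `DistCert`, bruteforce replay of 0 words) + two rank certificates (type-02 `RankCert`, `r_X = 0`, `r_Z = 0`), all by `decide` — tier KERNEL-std.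 [folklore] -/
theorem check_css_n4_k4 :
    ({ n := 4, HX := [], HZ := [],
        sideZ := { d := 1, witness := 1, nonmember := 1, found := [] },
        sideX := { d := 1, witness := 1, nonmember := 1, found := [] } } : DistCert).checkDistCert = true := by
  decide

/-- Rank certificate of `H^X` of `css_n4_k4` accepted (`rank = 0`, `decide`). [folklore] -/
theorem rankX_css_n4_k4 : ({ r := 0, pivots := [], rinv := [], dependent := [] } : RankCert).check 4 [] = true := by
  decide

/-- Rank certificate of `H^Z` of `css_n4_k4` accepted (`rank = 0`, `decide`). [folklore] -/
theorem rankZ_css_n4_k4 : ({ r := 0, pivots := [], rinv := [], dependent := [] } : RankCert).check 4 [] = true := by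
  decide

/-- **`css_n4_k4` is a `[[4, 4, 1]]` CSS code** (exact parameters, `CSSCode.IsCode`; KERNEL-std). [folklore] -/
theorem isCode_css_n4_k4 :
    (CSSCode.ofMatrices (rowMatrix 4 []) (rowMatrix 4 [])
      (comm_of_commOK (DistCert.commOK_of_check _ check_css_n4_k4))).IsCode 4 4 1 :=
  DistCert.isCode_code _ check_css_n4_k4 rankX_css_n4_k4 rankZ_css_n4_k4 (by decide)

/-- `d^X = 1` for `css_n4_k4` (KERNEL-std). [folklore] -/
theorem dX_css_n4_k4 :
    (CSSCode.ofMatrices (rowMatrix 4 []) (rowMatrix 4 [])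
      (comm_of_commOK (DistCert.commOK_of_check _ check_css_n4_k4))).dX = 1 :=
  DistCert.dX_code _ check_css_n4_k4

/-- `d^Z = 1` for `css_n4_k4` (KERNEL-std). [folklore] -/
theorem dZ_css_n4_k4 :
    (CSSCode.ofMatrices (rowMatrix 4 []) (rowMatrix 4 [])
      (comm_of_commOK (DistCert.commOK_of_check _ check_css_n4_k4))).dZ = 1 :=
  DistCert.dZ_code _ check_css_n4_k4

end Summit.Ventures.QEC.Census.CSS
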